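import Summits.QuantumFields.YangMills.Theorems.PoincareLipschitzSphereMapSmallRangeCaccioppoli
import Summits.QuantumFields.YangMills.Theorems.PoincareLipschitzSphereMapHarmonicExtensionNearSphere
import Summits.QuantumFields.YangMills.Theorems.PoincareLipschitzCovariantDirichlet
import Literature.MathematicalPhysics.QuantumFieldTheory.Balaban1983to89.B4Eq19LatticeHarmonicDecay
import Mathlib.Analysis.InnerProductSpace.PiL2
import HarnessLib

/-!
# Line «poincare_lipschitz» on crux `HistoryTailL` (stmt-QuantumFields-19936), route crux `BlockLipschitzL` (stmt-QuantumFields-23533), K2 organ of record `hReg` (LOC-REG-MIN) —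
# FLAT SHADOW «SMALL-RANGE DISCRETE REGULARITY INTO A SPHERE», FILE 2: ENERGY DECAY BY HARMONIC REPLACEMENT (Giaquinta–Giusti's direct method, NO weak Harnack):
# `E(u; Q_ρ(z)) ≤ (4A_d·((ρ+1)∕r)^d + (8A_d + 4)·2ω)·E(u; Q_{r+1}(z))` for one-site-optimal sphere-valued `u` with range in a ball of radius `ω` around `p`

Cell `ym3-torus` (YM ladder rung R3 = continuum SU(2) Yang–Mills on the three-torus — a RUNG, NOT the Clay problem: not d = 4, not infinite volume, not a
mass gap); width seat `ym3-torus-px7` gen 5 (LEAD ym-ust-19936-w1 g8 04:28:59Z∕04:37:48Z «SMALL-RANGE — GO: the direct-method small-range regularity is the portable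
half [of the organ's proof programme]»; my LOCATE `LOCATE-SMALL-RANGE-S3-px7g5.md` §1 (γ′)).  THEOREMS ONLY (def-free) over FILE 1 ✓`PoincareLipschitzSphereMapSmallRangeCaccioppoli`
((I1), (I2), small-range Caccioppoli), the (V, τ) Dirichlet file ✓`PoincareLipschitzCovariantDirichlet` read at the TRIVIAL transport (vector-valued Dirichlet problem and energy
identity on a box), and lit ✓`B4Eq19LatticeHarmonicDecay.harmonic_decay`; `--supports stmt-QuantumFields-19936`.  Nothing here proves `hReg`, the per-bond charts, a stub,
`BlockLipschitzL`, `HistoryTailL` or a summit statement; nothing twisted ∕ covariant.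

THE STEP (LOCATE §1 (γ′)).  On `Q_r(z)` let `w` solve the vector Dirichlet problem `−Δw = −Δu`, `w = 0` off the box, `h = u − w`.  Two facts make the replacement
error LINEAR IN THE ENERGY with the small factor `ω`: (i) the exact identity `Σ‖∇w‖² = Σ_{Q_r} λ·⟪w, u⟫` (energy identity ∘ (I1) `−Δu = λu`); (ii) the DISCRETE
MAXIMUM PRINCIPLE `‖h − p‖ ≤ ω` (its layer values are in the ball), so `⟪w,u⟫ ≤ ‖w‖ ≤ 2ω`.  Hence `E(w) ≤ 2ω·E(u;Q_{r+1})`, and with the harmonic energy decay of `h`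
(component by component, ✓`harmonic_decay`): `E(u;Q_ρ) ≤ 4A_d((ρ+1)∕r)^d·E(u;Q_{r+1}) + (8A_d+4)·2ω·E(u;Q_{r+1})`.  Iterated (FILE 3): Morrey decay and the HÖLDER law.

* §1 `exists_vec_dirichlet`, `vec_energy_identity` (✓`exists_cov_dirichlet` ∕ ✓`energy_identity` at the trivial transport); §2 ★ `norm_sub_le_of_vecHarmonic` (over the landed scalar
  maximum principle ✓`PoincareLipschitzSphereMapHarmonicExtensionNearSphere.le_of_subharmonic_of_le_on_layer`, ★w5 g12); §3 `vecEnergy_eq_sum_gradSq` (Parseval), ★ `vec_harmonic_decay`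
  (the vector-valued ✓`harmonic_decay`); §4 ★★ `smallRange_energy_decay` — the title.
[folklore] ([Giaquinta1984] Ch. VI §1 Thm 1.1 step II (harmonic replacement, energy decay) pp.128–131, §3 Thm 3.2; [Giaquinta1984] Ch. III Lemma 2.1 for the iteration (FILE 3)).
-/

set_option autoImplicit false

noncomputable section

open scoped BigOperators InnerProductSpace
open Finset

namespace Summit.QuantumFields.YangMills.Theorems.PoincareLipschitzSphereMapSmallRangeEnergyDecay

open Literature.MathematicalPhysics.QuantumFieldTheory.Balaban1983to89
open B4Eq19LatticeOperators
open B4Eq19LatticeHarmonicDecay (harmonic_decay)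
open Summit.QuantumFields.YangMills.Theorems.PoincareLipschitzCovariantDirichlet (exists_cov_dirichlet energy_identity energy_le_of_support)
open Summit.QuantumFields.YangMills.Theorems.PoincareLipschitzSphereMapSmallRangeCaccioppoli (one_sub_inner_eq one_sub_inner_nonneg nbr_sum_sub_eq)
open Summit.QuantumFields.YangMills.Theorems.PoincareLipschitzSphereMapHarmonicExtensionNearSphere (le_of_subharmonic_of_le_on_layer)

variable {d : ℕ} {V : Type*} [NormedAddCommGroup V] [InnerProductSpace ℝ V]

/-! ## §1 The vector-valued Dirichlet problem and energy identity on a box (trivial transport) -/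

/-- THE VECTOR-VALUED DIRICHLET PROBLEM ON A BOX (`d ≥ 1`, `V` finite-dimensional): for every `ψ` there is `w` with `w = 0` off `Q_r(z)` and `−Δw = ψ` on `Q_r(z)`
(`−Δw(y) = Σ_μ (2w(y) − w(y−e_μ) − w(y+e_μ))`).  ✓`exists_cov_dirichlet` at the trivial transport. [folklore] [cite: Giaquinta1984, Ch. VI §1 p.129] -/
theorem exists_vec_dirichlet [FiniteDimensional ℝ V] (hd : 0 < d) (z : Zd d) (r : ℤ) (ψ : Zd d → V) :
    ∃ w : Zd d → V, (∀ y ∉ box z r, w y = 0) ∧ ∀ y ∈ box z r, ∑ μ, ((w y + w y) - w (y - unitVec μ) - w (y + unitVec μ)) = ψ y := by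
  obtain ⟨w, hw0, hw⟩ := exists_cov_dirichlet hd (fun _ _ => LinearIsometryEquiv.refl ℝ V) (κ := 0) le_rfl z r ψ
  refine ⟨w, hw0, fun y hy => ?_⟩
  have h := hw y hy
  have hs : (LinearIsometryEquiv.refl ℝ V).symm = LinearIsometryEquiv.refl ℝ V := rfl
  simpa [hs] using h

/-- THE VECTOR ENERGY IDENTITY: for `w` vanishing off `Q_{R−1}(z)`, `Σ_{Q_R} ⟪w, −Δw⟫ = Σ_{Q_R} Σ_μ ‖w(y+e_μ) − w(y)‖²`.  ✓`energy_identity` at the trivial transport.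
[folklore] [cite: Giaquinta1984, Ch. VI §1 p.129] -/
theorem vec_energy_identity (w : Zd d → V) (z : Zd d) (R : ℤ) (hw : ∀ y ∉ box z (R - 1), w y = 0) :
    ∑ y ∈ box z R, ⟪w y, ∑ μ, ((w y + w y) - w (y - unitVec μ) - w (y + unitVec μ))⟫_ℝ = ∑ y ∈ box z R, ∑ μ, ‖w (y + unitVec μ) - w y‖ ^ 2 := by
  have h := energy_identity (fun _ _ => LinearIsometryEquiv.refl ℝ V) 0 w z R hw
  have hs : (LinearIsometryEquiv.refl ℝ V).symm = LinearIsometryEquiv.refl ℝ V := rfl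
  simpa [hs] using h

/-! ## §2 The maximum principle, vector form (the scalar one is ★w5 g12's ✓`PoincareLipschitzSphereMapHarmonicExtensionNearSphere`) -/

/-- ★ **A COMPONENTWISE-HARMONIC VECTOR MAP STAYS IN THE BALL OF ITS BOUNDARY VALUES**: `d ≥ 1`, `r ≥ 0`; if `−Δh = 0` (vector Laplacian) on `Q_r(z)` and
`‖h(x) − p‖ ≤ ω` on the layer `Q_{r+1}(z) ∖ Q_r(z)`, then `‖h(y) − p‖ ≤ ω` on `Q_{r+1}(z)` (the maximum principle for `⟪h − p, v⟫`, `v = h(y) − p`). [folklore]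
[cite: Giaquinta1984, Ch. VI §3 p.136] -/
theorem norm_sub_le_of_vecHarmonic (hd : 0 < d) (h : Zd d → V) (p : V) (z : Zd d) {r : ℤ} (hr : 0 ≤ r) {ω : ℝ}
    (hh : ∀ y ∈ box z r, ∑ μ, ((h y + h y) - h (y - unitVec μ) - h (y + unitVec μ)) = 0)
    (hω : ∀ x ∈ box z (r + 1), x ∉ box z r → ‖h x - p‖ ≤ ω) :
    ∀ y ∈ box z (r + 1), ‖h y - p‖ ≤ ω := by
  intro y hy
  set v : V := h y - p with hv
  by_cases hv0 : v = 0
  · rw [hv0, norm_zero]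
    obtain ⟨x, hx, hxn⟩ : ∃ x ∈ box z (r + 1), x ∉ box z r := by
      refine ⟨z + (r + 1) • unitVec ⟨0, hd⟩, ?_, ?_⟩
      · rw [mem_box]; intro i
        by_cases hi : i = ⟨0, hd⟩
        · subst hi; simp [unitVec, abs_of_nonneg (show (0:ℤ) ≤ r + 1 by linarith)]
        · simp [unitVec, Pi.single_eq_of_ne hi]; linarith
      · intro hmem
        have := (mem_box.1 hmem) ⟨0, hd⟩
        simp [unitVec, abs_of_nonneg (show (0:ℤ) ≤ r + 1 by linarith)] at this
    exact (norm_nonneg _).trans (hω x hx hxn)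
  -- the scalar harmonic function `f = ⟪h − p, v⟫`
  set f : Zd d → ℝ := fun x => ⟪h x - p, v⟫_ℝ with hf
  have hfh : ∀ x ∈ box z r, lop 0 f x = 0 := by
    intro x hx
    have e : lop 0 f x = ⟪∑ μ, ((h x + h x) - h (x - unitVec μ) - h (x + unitVec μ)), v⟫_ℝ := by
      rw [lop_apply, zero_mul, add_zero, sum_inner]
      refine Finset.sum_congr rfl fun μ _ => ?_
      simp only [hf, inner_sub_left, inner_add_left]; ring
    rw [e, hh x hx, inner_zero_left]
  have hfM : ∀ x ∈ box z (r + 1), x ∉ box z r → f x ≤ ω * ‖v‖ := by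
    intro x hx hxn
    calc f x ≤ ‖h x - p‖ * ‖v‖ := real_inner_le_norm _ _
      _ ≤ ω * ‖v‖ := mul_le_mul_of_nonneg_right (hω x hx hxn) (norm_nonneg _)
  have hfy := le_of_subharmonic_of_le_on_layer hd f z hr (fun x hx => (hfh x hx).le) hfM y hy
  have e : f y = ‖v‖ ^ 2 := by simp only [hf, ← hv, real_inner_self_eq_norm_sq]
  rw [e, sq] at hfy
  exact le_of_mul_le_mul_right hfy (norm_pos_iff.2 hv0)

/-! ## §3 The vector-valued harmonic energy decay (Parseval in an orthonormal basis) -/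

/-- PARSEVAL FOR THE VECTOR ENERGY: with `b` the standard orthonormal basis of a finite-dimensional `V`,
`Σ_{y∈Q} Σ_μ ‖g(y+e_μ) − g(y)‖² = Σ_i gradSq ⟪g ·, b i⟫ (Q)`. [folklore] -/
theorem vecEnergy_eq_sum_gradSq [FiniteDimensional ℝ V] (g : Zd d → V) (Q : Finset (Zd d)) :
    ∑ y ∈ Q, ∑ μ, ‖g (y + unitVec μ) - g y‖ ^ 2 = ∑ i, gradSq (fun y => ⟪g y, stdOrthonormalBasis ℝ V i⟫_ℝ) Q := by
  set b := stdOrthonormalBasis ℝ V with hb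
  have hpars : ∀ v : V, ‖v‖ ^ 2 = ∑ i, ⟪v, b i⟫_ℝ ^ 2 := by
    intro v
    rw [← real_inner_self_eq_norm_sq, ← b.sum_inner_mul_inner v v]
    exact Finset.sum_congr rfl fun i _ => by rw [real_inner_comm (b i) v, sq]
  symm
  calc ∑ i, gradSq (fun y => ⟪g y, b i⟫_ℝ) Q = ∑ i, ∑ y ∈ Q, ∑ μ, ⟪g (y + unitVec μ) - g y, b i⟫_ℝ ^ 2 := by
        refine Finset.sum_congr rfl fun i _ => ?_
        rw [gradSq_def]
        refine Finset.sum_congr rfl fun y _ => Finset.sum_congr rfl fun μ _ => ?_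
        rw [fdiff_apply, ← inner_sub_left]
    _ = ∑ y ∈ Q, ∑ i, ∑ μ, ⟪g (y + unitVec μ) - g y, b i⟫_ℝ ^ 2 := Finset.sum_comm
    _ = ∑ y ∈ Q, ∑ μ, ∑ i, ⟪g (y + unitVec μ) - g y, b i⟫_ℝ ^ 2 := Finset.sum_congr rfl fun y _ => Finset.sum_comm
    _ = ∑ y ∈ Q, ∑ μ, ‖g (y + unitVec μ) - g y‖ ^ 2 :=
        Finset.sum_congr rfl fun y _ => Finset.sum_congr rfl fun μ _ => (hpars _).symm

/-- ★ **THE VECTOR-VALUED HARMONIC ENERGY DECAY**: `V` finite-dimensional, `0 ≤ ρ ≤ r`; if `−Δh = 0` (vector Laplacian) on `Q_{r+1}(z)`, then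
`Σ_{Q_ρ} Σ_μ ‖h(y+e_μ) − h(y)‖² ≤ A_d·((ρ+1)∕(r+1))^d·Σ_{Q_r} Σ_μ ‖h(y+e_μ) − h(y)‖²`, `A_d = 2^d(1+56d)^d(8(d+1))^{d+1}` (✓`harmonic_decay` component by component).
[folklore] [cite: Giaquinta1984, Ch. III §2 (2.8) p.80; Ch. VI §1 p.130] -/
theorem vec_harmonic_decay [FiniteDimensional ℝ V] {z : Zd d} {ρ r : ℤ} (hρ : 0 ≤ ρ) (hρr : ρ ≤ r) (h : Zd d → V)
    (hh : ∀ y ∈ box z (r + 1), ∑ μ, ((h y + h y) - h (y - unitVec μ) - h (y + unitVec μ)) = 0) :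
    ∑ y ∈ box z ρ, ∑ μ, ‖h (y + unitVec μ) - h y‖ ^ 2 ≤
      (2 : ℝ) ^ d * (1 + 56 * d) ^ d * (8 * ((d : ℝ) + 1)) ^ (d + 1) * (((ρ : ℝ) + 1) / ((r : ℝ) + 1)) ^ d *
        ∑ y ∈ box z r, ∑ μ, ‖h (y + unitVec μ) - h y‖ ^ 2 := by
  set b := stdOrthonormalBasis ℝ V with hb
  rw [vecEnergy_eq_sum_gradSq h (box z ρ), vecEnergy_eq_sum_gradSq h (box z r), Finset.mul_sum]
  refine Finset.sum_le_sum fun i _ => ?_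
  refine harmonic_decay (κ := 0) le_rfl hρ hρr (fun y => ⟪h y, stdOrthonormalBasis ℝ V i⟫_ℝ) fun y hy => ?_
  have e : lop 0 (fun x => ⟪h x, stdOrthonormalBasis ℝ V i⟫_ℝ) y = ⟪∑ μ, ((h y + h y) - h (y - unitVec μ) - h (y + unitVec μ)), stdOrthonormalBasis ℝ V i⟫_ℝ := by
    rw [lop_apply, zero_mul, add_zero, sum_inner]
    refine Finset.sum_congr rfl fun μ _ => ?_
    rw [inner_sub_left, inner_sub_left, inner_add_left]; ring
  rw [e, hh y hy, inner_zero_left]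

/-! ## §4 ★★ The energy decay step for small-range one-site-optimal sphere maps -/

/-- ★★ **ENERGY DECAY BY HARMONIC REPLACEMENT (SMALL RANGE, NO WEAK HARNACK).**  `V` finite-dimensional, `d ≥ 1`, `r ≥ 1`, `0 ≤ ρ ≤ r − 1`; `u : ℤ^d → V` with
`‖u‖ = 1` and `‖u − p‖ ≤ ω` (`0 ≤ ω`) on `Q_{r+2}(z)`, one-site optimal (`‖N‖·u = N`) on `Q_{r+1}(z)`.  Then, with `A_d = 2^d(1+56d)^d(8(d+1))^{d+1}`,
`E(u;Q_ρ(z)) ≤ (4A_d·((ρ+1)∕r)^d + (8A_d + 4)·(2ω))·E(u;Q_{r+1}(z))`, `E(u;Q) := Σ_{y∈Q}Σ_μ ‖u(y+e_μ) − u(y)‖²`.  Proof: vector Dirichlet corrector `w` on `Q_r(z)`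
(`−Δw = −Δu = λu` there, `w = 0` outside), `h = u − w` harmonic on `Q_r(z)`; `E(w) = Σ_{Q_r}λ⟪w,u⟫ ≤ 2ω·Σ_{Q_r}λ ≤ 2ω·E(u;Q_{r+1})` (energy identity, (I1), and
`‖w‖ ≤ 2ω` by the discrete maximum principle for `h`); `E(h;Q_ρ) ≤ A_d((ρ+1)∕r)^d·E(h;Q_{r−1})` (✓`vec_harmonic_decay`); triangle inequalities.
[folklore] [cite: Giaquinta1984, Ch. VI §1 Thm 1.1 step II pp.129–131, §3 Thm 3.2 p.137] -/
theorem smallRange_energy_decay [FiniteDimensional ℝ V] (hd : 1 ≤ d) (u : Zd d → V) (p : V) (z : Zd d) {ρ r : ℤ} (hρ : 0 ≤ ρ) (hr : 1 ≤ r)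
    (hρr : ρ + 1 ≤ r) {ω : ℝ} (hω0 : 0 ≤ ω)
    (hu1 : ∀ y ∈ box z (r + 2), ‖u y‖ = 1) (hω : ∀ y ∈ box z (r + 2), ‖u y - p‖ ≤ ω)
    (hopt : ∀ y ∈ box z (r + 1),
      ‖∑ μ, (u (y + unitVec μ) + u (y - unitVec μ))‖ • u y = ∑ μ, (u (y + unitVec μ) + u (y - unitVec μ))) :
    ∑ y ∈ box z ρ, ∑ μ, ‖u (y + unitVec μ) - u y‖ ^ 2 ≤
      (4 * ((2 : ℝ) ^ d * (1 + 56 * d) ^ d * (8 * ((d : ℝ) + 1)) ^ (d + 1)) * (((ρ : ℝ) + 1) / (r : ℝ)) ^ d +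
        (8 * ((2 : ℝ) ^ d * (1 + 56 * d) ^ d * (8 * ((d : ℝ) + 1)) ^ (d + 1)) + 4) * (2 * ω)) *
        ∑ y ∈ box z (r + 1), ∑ μ, ‖u (y + unitVec μ) - u y‖ ^ 2 := by
  classical
  have hd0 : 0 < d := hd
  set A : ℝ := (2 : ℝ) ^ d * (1 + 56 * d) ^ d * (8 * ((d : ℝ) + 1)) ^ (d + 1) with hA
  have hA0 : 0 ≤ A := by positivity
  set E : Finset (Zd d) → ℝ := fun Q => ∑ y ∈ Q, ∑ μ, ‖u (y + unitVec μ) - u y‖ ^ 2 with hE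
  have hE0 : ∀ Q, 0 ≤ E Q := fun Q => Finset.sum_nonneg fun _ _ => Finset.sum_nonneg fun _ _ => sq_nonneg _
  set lam : Zd d → ℝ := fun y => ∑ μ, ((1 - ⟪u y, u (y + unitVec μ)⟫_ℝ) + (1 - ⟪u y, u (y - unitVec μ)⟫_ℝ)) with hlam
  -- memberships
  have hm2 : ∀ y ∈ box z r, y ∈ box z (r + 2) := fun y hy => box_mono z (by linarith) hy
  have hm2p : ∀ y ∈ box z r, ∀ μ, y + unitVec μ ∈ box z (r + 2) := fun y hy μ => box_mono z (by linarith) (add_unitVec_mem_box hy μ)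
  have hm2m : ∀ y ∈ box z r, ∀ μ, y - unitVec μ ∈ box z (r + 2) := fun y hy μ => box_mono z (by linarith) (sub_unitVec_mem_box hy μ)
  have hm1 : ∀ y ∈ box z r, y ∈ box z (r + 1) := fun y hy => box_mono z (by linarith) hy
  -- §a the vector Dirichlet corrector `w` and the harmonic part `h = u − w`
  obtain ⟨w, hw0, hw⟩ := exists_vec_dirichlet hd0 z r (fun y => ∑ μ, ((u y + u y) - u (y - unitVec μ) - u (y + unitVec μ)))
  set h : Zd d → V := fun y => u y - w y with hh
  have hharm : ∀ y ∈ box z r, ∑ μ, ((h y + h y) - h (y - unitVec μ) - h (y + unitVec μ)) = 0 := by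
    intro y hy
    have e : ∑ μ, ((h y + h y) - h (y - unitVec μ) - h (y + unitVec μ)) =
        ∑ μ, ((u y + u y) - u (y - unitVec μ) - u (y + unitVec μ)) - ∑ μ, ((w y + w y) - w (y - unitVec μ) - w (y + unitVec μ)) := by
      rw [← Finset.sum_sub_distrib]; exact Finset.sum_congr rfl fun μ _ => by simp only [hh]; abel
    rw [e, hw y hy, sub_self]
  -- §b (I1): `−Δu = λ•u` on `Q_r(z)`, and `0 ≤ λ ≤` forward+backward energy
  have hI1 : ∀ y ∈ box z r, ∑ μ, ((u y + u y) - u (y - unitVec μ) - u (y + unitVec μ)) = lam y • u y := by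
    intro y hy
    have hn := nbr_sum_sub_eq u y (hu1 y (hm2 y hy)) (hopt y (hm1 y hy))
    have e : ∑ μ, ((u y + u y) - u (y - unitVec μ) - u (y + unitVec μ)) = -∑ μ, ((u (y + unitVec μ) - u y) + (u (y - unitVec μ) - u y)) := by
      rw [← Finset.sum_neg_distrib]; exact Finset.sum_congr rfl fun μ _ => by abel
    rw [e, hn, neg_smul, neg_neg]
  have hlam0 : ∀ y ∈ box z r, 0 ≤ lam y := fun y hy =>
    Finset.sum_nonneg fun μ _ => add_nonneg (one_sub_inner_nonneg (hu1 y (hm2 y hy)) (hu1 _ (hm2p y hy μ)))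
      (one_sub_inner_nonneg (hu1 y (hm2 y hy)) (hu1 _ (hm2m y hy μ)))
  have hlamE : ∑ y ∈ box z r, lam y ≤ E (box z (r + 1)) := by
    -- `λ(y) = ½Σ_μ(‖u(y+e)−u y‖² + ‖u(y−e)−u y‖²)`; the backward terms, reindexed, are forward terms at `y − e_μ ∈ Q_{r+1}`
    have hfw : ∑ y ∈ box z r, ∑ μ, (1 - ⟪u y, u (y + unitVec μ)⟫_ℝ) ≤ (1 / 2) * E (box z (r + 1)) := by
      rw [hE]; dsimp only
      rw [Finset.mul_sum]
      calc ∑ y ∈ box z r, ∑ μ, (1 - ⟪u y, u (y + unitVec μ)⟫_ℝ) = ∑ y ∈ box z r, (1 / 2) * ∑ μ, ‖u (y + unitVec μ) - u y‖ ^ 2 := by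
            refine Finset.sum_congr rfl fun y hy => ?_
            rw [Finset.mul_sum]
            refine Finset.sum_congr rfl fun μ _ => ?_
            rw [one_sub_inner_eq (hu1 y (hm2 y hy)) (hu1 _ (hm2p y hy μ)), norm_sub_rev]
        _ ≤ ∑ y ∈ box z (r + 1), (1 / 2) * ∑ μ, ‖u (y + unitVec μ) - u y‖ ^ 2 :=
            Finset.sum_le_sum_of_subset_of_nonneg (box_mono z (by linarith)) fun _ _ _ => by positivity
    have hbw : ∑ y ∈ box z r, ∑ μ, (1 - ⟪u y, u (y - unitVec μ)⟫_ℝ) ≤ (1 / 2) * E (box z (r + 1)) := by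
      have hper : ∀ μ : Fin d, ∑ y ∈ box z r, (1 - ⟪u y, u (y - unitVec μ)⟫_ℝ) ≤ ∑ x ∈ box z (r + 1), (1 / 2) * ‖u (x + unitVec μ) - u x‖ ^ 2 := by
        intro μ
        have e1 : ∑ y ∈ box z r, (1 - ⟪u y, u (y - unitVec μ)⟫_ℝ) = ∑ y ∈ box z r, (1 / 2) * ‖u (y - unitVec μ + unitVec μ) - u (y - unitVec μ)‖ ^ 2 := by
          refine Finset.sum_congr rfl fun y hy => ?_
          rw [sub_add_cancel, one_sub_inner_eq (hu1 y (hm2 y hy)) (hu1 _ (hm2m y hy μ))]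
        have e2 : ∑ y ∈ box z r, (1 / 2) * ‖u (y - unitVec μ + unitVec μ) - u (y - unitVec μ)‖ ^ 2 =
            ∑ x ∈ (box z r).image (fun y => y - unitVec μ), (1 / 2) * ‖u (x + unitVec μ) - u x‖ ^ 2 := by
          rw [Finset.sum_image (fun a _ b _ hab => sub_left_injective hab)]
        have hsub : (box z r).image (fun y => y - unitVec μ) ⊆ box z (r + 1) := by
          intro x hx
          obtain ⟨y, hy, rfl⟩ := Finset.mem_image.1 hx
          exact sub_unitVec_mem_box hy μ
        rw [e1, e2]
        exact Finset.sum_le_sum_of_subset_of_nonneg hsub fun _ _ _ => by positivity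
      calc ∑ y ∈ box z r, ∑ μ, (1 - ⟪u y, u (y - unitVec μ)⟫_ℝ) = ∑ μ, ∑ y ∈ box z r, (1 - ⟪u y, u (y - unitVec μ)⟫_ℝ) := Finset.sum_comm
        _ ≤ ∑ μ, ∑ x ∈ box z (r + 1), (1 / 2) * ‖u (x + unitVec μ) - u x‖ ^ 2 := Finset.sum_le_sum fun μ _ => hper μ
        _ = (1 / 2) * E (box z (r + 1)) := by
            rw [hE]; dsimp only
            rw [Finset.mul_sum, Finset.sum_comm]
            exact Finset.sum_congr rfl fun x _ => by rw [Finset.mul_sum]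
    calc ∑ y ∈ box z r, lam y = ∑ y ∈ box z r, ∑ μ, (1 - ⟪u y, u (y + unitVec μ)⟫_ℝ) + ∑ y ∈ box z r, ∑ μ, (1 - ⟪u y, u (y - unitVec μ)⟫_ℝ) := by
          rw [← Finset.sum_add_distrib]; exact Finset.sum_congr rfl fun y _ => Finset.sum_add_distrib
      _ ≤ (1 / 2) * E (box z (r + 1)) + (1 / 2) * E (box z (r + 1)) := add_le_add hfw hbw
      _ = E (box z (r + 1)) := by ring
  -- §c the maximum principle: `‖h − p‖ ≤ ω` on `Q_{r+1}`, hence `‖w‖ ≤ 2ω` on `Q_r`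
  have hr0 : 0 ≤ r := by linarith
  have hhp : ∀ y ∈ box z (r + 1), ‖h y - p‖ ≤ ω := by
    refine norm_sub_le_of_vecHarmonic hd0 h p z hr0 hharm fun x hx hxn => ?_
    have : h x = u x := by simp only [hh, hw0 x hxn, sub_zero]
    rw [this]; exact hω x (box_mono z (by linarith) hx)
  have hwn : ∀ y ∈ box z r, ‖w y‖ ≤ 2 * ω := by
    intro y hy
    have e : w y = (u y - p) - (h y - p) := by simp only [hh]; abel
    rw [e]
    calc ‖(u y - p) - (h y - p)‖ ≤ ‖u y - p‖ + ‖h y - p‖ := norm_sub_le _ _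
      _ ≤ ω + ω := add_le_add (hω y (hm2 y hy)) (hhp y (hm1 y hy))
      _ = 2 * ω := by ring
  -- §d the corrector energy: `E(w; Q_{r+1}) = Σ_{Q_r} λ⟪w,u⟫ ≤ 2ω·E(u;Q_{r+1})`
  have hwE : ∑ y ∈ box z (r + 1), ∑ μ, ‖w (y + unitVec μ) - w y‖ ^ 2 ≤ 2 * ω * E (box z (r + 1)) := by
    have hid := vec_energy_identity w z (r + 1) (fun y hy => hw0 y (by simpa using hy))
    rw [← hid]
    have e1 : ∑ y ∈ box z (r + 1), ⟪w y, ∑ μ, ((w y + w y) - w (y - unitVec μ) - w (y + unitVec μ))⟫_ℝ = ∑ y ∈ box z r, lam y * ⟪w y, u y⟫_ℝ := by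
      rw [← Finset.sum_subset (box_mono z (by linarith : r ≤ r + 1))
        (fun y _ hy => by rw [hw0 y hy, inner_zero_left])]
      refine Finset.sum_congr rfl fun y hy => ?_
      rw [hw y hy, hI1 y hy, real_inner_smul_right]
    rw [e1]
    calc ∑ y ∈ box z r, lam y * ⟪w y, u y⟫_ℝ ≤ ∑ y ∈ box z r, lam y * (2 * ω) := Finset.sum_le_sum fun y hy => by
            refine mul_le_mul_of_nonneg_left ?_ (hlam0 y hy)
            calc ⟪w y, u y⟫_ℝ ≤ ‖w y‖ * ‖u y‖ := real_inner_le_norm _ _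
              _ = ‖w y‖ := by rw [hu1 y (hm2 y hy), mul_one]
              _ ≤ 2 * ω := hwn y hy
      _ = 2 * ω * ∑ y ∈ box z r, lam y := by rw [← Finset.sum_mul]; ring
      _ ≤ 2 * ω * E (box z (r + 1)) := mul_le_mul_of_nonneg_left hlamE (by positivity)
  have hwE' : ∀ Q : Finset (Zd d), ∑ y ∈ Q, ∑ μ, ‖w (y + unitVec μ) - w y‖ ^ 2 ≤ 2 * ω * E (box z (r + 1)) := by
    intro Q
    have hsupp := energy_le_of_support (fun _ _ => LinearIsometryEquiv.refl ℝ V) hw0 Q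
    simp only [LinearIsometryEquiv.coe_refl, id_eq] at hsupp
    exact hsupp.trans hwE
  -- §e the harmonic part: energy decay from `Q_{r−1}` to `Q_ρ`, and `E(h;Q_{r−1}) ≤ 2E(u;Q_{r+1}) + 2E(w)`
  have htri : ∀ (Q : Finset (Zd d)) (f g : Zd d → V),
      ∑ y ∈ Q, ∑ μ, ‖(f (y + unitVec μ) + g (y + unitVec μ)) - (f y + g y)‖ ^ 2 ≤
        2 * ∑ y ∈ Q, ∑ μ, ‖f (y + unitVec μ) - f y‖ ^ 2 + 2 * ∑ y ∈ Q, ∑ μ, ‖g (y + unitVec μ) - g y‖ ^ 2 := by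
    intro Q f g
    rw [Finset.mul_sum, Finset.mul_sum, ← Finset.sum_add_distrib]
    refine Finset.sum_le_sum fun y _ => ?_
    rw [Finset.mul_sum, Finset.mul_sum, ← Finset.sum_add_distrib]
    refine Finset.sum_le_sum fun μ _ => ?_
    have e : (f (y + unitVec μ) + g (y + unitVec μ)) - (f y + g y) = (f (y + unitVec μ) - f y) + (g (y + unitVec μ) - g y) := by abel
    rw [e]
    have h1 : ‖(f (y + unitVec μ) - f y) + (g (y + unitVec μ) - g y)‖ ^ 2 ≤ (‖f (y + unitVec μ) - f y‖ + ‖g (y + unitVec μ) - g y‖) ^ 2 :=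
      pow_le_pow_left₀ (norm_nonneg _) (norm_add_le _ _) 2
    nlinarith [h1, sq_nonneg (‖f (y + unitVec μ) - f y‖ - ‖g (y + unitVec μ) - g y‖)]
  have hdec := vec_harmonic_decay (z := z) hρ (by linarith : ρ ≤ r - 1) h (fun y hy => hharm y (by simpa using hy))
  rw [← hA] at hdec
  have er : (((r - 1 : ℤ) : ℝ) + 1) = (r : ℝ) := by push_cast; ring
  rw [er] at hdec
  -- `E(u;Q_ρ) ≤ 2E(h;Q_ρ) + 2E(w;Q_ρ)`
  have hu_ρ : E (box z ρ) ≤ 2 * ∑ y ∈ box z ρ, ∑ μ, ‖h (y + unitVec μ) - h y‖ ^ 2 + 2 * ∑ y ∈ box z ρ, ∑ μ, ‖w (y + unitVec μ) - w y‖ ^ 2 := by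
    have := htri (box z ρ) h w
    have e : ∀ y μ, (h (y + unitVec μ) + w (y + unitVec μ)) - (h y + w y) = u (y + unitVec μ) - u y := fun y μ => by simp only [hh]; abel
    simp only [e] at this
    exact this
  -- `E(h;Q_{r−1}) ≤ 2E(u;Q_{r−1}) + 2E(w;Q_{r−1}) ≤ 2E(u;Q_{r+1}) + 2E(w)`
  have hh_r : ∑ y ∈ box z (r - 1), ∑ μ, ‖h (y + unitVec μ) - h y‖ ^ 2 ≤ 2 * E (box z (r + 1)) + 2 * (2 * ω * E (box z (r + 1))) := by
    have := htri (box z (r - 1)) u (fun y => -w y)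
    have e : ∀ y μ, (u (y + unitVec μ) + -w (y + unitVec μ)) - (u y + -w y) = h (y + unitVec μ) - h y := fun y μ => by simp only [hh]; abel
    have e2 : ∀ y μ, ‖-w (y + unitVec μ) - -w y‖ = ‖w (y + unitVec μ) - w y‖ := fun y μ => by
      rw [← norm_neg]; congr 1; abel
    simp only [e, e2] at this
    have hmono : E (box z (r - 1)) ≤ E (box z (r + 1)) :=
      Finset.sum_le_sum_of_subset_of_nonneg (box_mono z (by linarith)) fun _ _ _ => Finset.sum_nonneg fun _ _ => sq_nonneg _
    have hwr := hwE' (box z (r - 1))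
    calc ∑ y ∈ box z (r - 1), ∑ μ, ‖h (y + unitVec μ) - h y‖ ^ 2
        ≤ 2 * E (box z (r - 1)) + 2 * ∑ y ∈ box z (r - 1), ∑ μ, ‖w (y + unitVec μ) - w y‖ ^ 2 := this
      _ ≤ 2 * E (box z (r + 1)) + 2 * (2 * ω * E (box z (r + 1))) := by linarith
  -- assemble
  have hrR : (0 : ℝ) < r := by exact_mod_cast (show (0 : ℤ) < r by linarith)
  have hρR0 : (0 : ℝ) ≤ ρ := by exact_mod_cast hρ
  have hq0 : 0 ≤ (((ρ : ℝ) + 1) / (r : ℝ)) ^ d := by positivity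
  have hAq : 0 ≤ A * (((ρ : ℝ) + 1) / (r : ℝ)) ^ d := mul_nonneg hA0 hq0
  have hwρ := hwE' (box z ρ)
  have hEr := hE0 (box z (r + 1))
  calc E (box z ρ) ≤ 2 * ∑ y ∈ box z ρ, ∑ μ, ‖h (y + unitVec μ) - h y‖ ^ 2 + 2 * ∑ y ∈ box z ρ, ∑ μ, ‖w (y + unitVec μ) - w y‖ ^ 2 := hu_ρ
    _ ≤ 2 * (A * (((ρ : ℝ) + 1) / (r : ℝ)) ^ d * (2 * E (box z (r + 1)) + 2 * (2 * ω * E (box z (r + 1))))) + 2 * (2 * ω * E (box z (r + 1))) := by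
        have t1 := hdec.trans (mul_le_mul_of_nonneg_left hh_r hAq)
        linarith
    _ = (4 * A * (((ρ : ℝ) + 1) / (r : ℝ)) ^ d + (8 * (A * (((ρ : ℝ) + 1) / (r : ℝ)) ^ d) + 4) * ω) * E (box z (r + 1)) := by ring
    _ ≤ (4 * A * (((ρ : ℝ) + 1) / (r : ℝ)) ^ d + (8 * A + 4) * (2 * ω)) * E (box z (r + 1)) := by
        apply mul_le_mul_of_nonneg_right _ hEr
        have hρr' : (ρ : ℝ) + 1 ≤ r := by exact_mod_cast hρr
        have hq1 : (((ρ : ℝ) + 1) / (r : ℝ)) ^ d ≤ 1 := pow_le_one₀ (by positivity) (by rw [div_le_one hrR]; exact hρr')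
        have hAq1 : A * (((ρ : ℝ) + 1) / (r : ℝ)) ^ d ≤ A := mul_le_of_le_one_right hA0 hq1
        have h84 : 0 ≤ (8 * A + 4) * ω := by positivity
        nlinarith [hAq1, hω0, h84, hAq]

end Summit.QuantumFields.YangMills.Theorems.PoincareLipschitzSphereMapSmallRangeEnergyDecay

end
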